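import Literature.Barriers.FinalStateConjecture.NonSmoothNullInfinityRegion
import Literature.Barriers.FinalStateConjecture.NonSmoothNullInfinityFutureLimit
import Mathlib.Analysis.Calculus.IteratedDeriv.Lemmas
import Mathlib.Analysis.Calculus.ContDiff.Polynomial
import HarnessLib

/-!
# Barrier catalogue `FinalStateConjecture`: the linear scattering problem on Schwarzschild —
# the decay estimate (6.17) at order `n = 0` and the `v`-derivative bounds of the scattering field
(`Literature/Barriers/FinalStateConjecture/`, D-0021, D-0014; namespace
`Literature.Barriers.FinalStateConjecture`, sub-namespace `ScatDecay` for the bootstrap lemmas)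

For the scattering field `χ = scatteringField …` of data `H` (smooth, supported in `(v₁, v₂)`) on the
early-time region `GoodRegion M r v₁ v₂ U₀ A` (`NonSmoothNullInfinityRegion.lean`) this file runs
the first rounds of Kehrberger's decay bootstrap (arXiv:2105.08079v3, proof of Thm. 4.2 transplanted
to the linear setting of §6, Thm. 6.1): with `Ξ := ∫_{−∞}^{u} Vχ du'` (so `χ = H − ∫_{v₁}^{v} Ξ`,
`∂ᵥχ = H' − Ξ`),

* `ScatDecay.abs_sub_data_le_inv` — `|χ − H| ≤ 8 M C_H/|u|` (from `|χ| ≤ 2C_H` near `𝓘⁻` and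
  `∫_{−∞}^{u} V = M/r²`, `∫_{v₁}^{v} M/r² ≤ 2M/r(u,v₁) ≤ 4M/|u|`);
* `ScatDecay.uPrimitive_eq` — the splitting `Ξ(u,v) = H(v) M/r(u,v)² + R(u,v)`,
  `R = ∫_{−∞}^{u} V(χ − H)`, and `ScatDecay.abs_sub_data_le_sq` — **`|χ − H| ≤ B₂/u²`** (eq. (6.3) at
  leading order: the size bootstrap `O(1) ⇒ O(|u|⁻¹) ⇒ O(u⁻²)`);
* `ScatDecay.abs_add_moment_le` — **`|χ(u,v) + M(∫H)/u²| ≤ C log|u|/|u|³` on `{u ≤ U₀, v ≥ v₂}`**,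
  i.e. Kehrberger's (6.3)/(6.17) at `n = 0` in the Eddington–Finkelstein gauge, where the `|u|⁻³`
  error of (6.3) becomes `|u|⁻³ log|u|` (§6.2, footnote 55) through the strip comparison
  `|1/r² − 1/u²| ≤ C log|u|/|u|³`; the class-level statement is
  `SchwarzschildLinearScattering_uDecay_zero` (any `IsScatteringSolution`, by uniqueness);
* `ScatDecay.abs_futureLimit_add_moment_le`, `ScatDecay.abs_sub_futureLimit_le` — the same for the
  limit `χ(u, ∞)` on `𝓘⁺`, and `|χ(u,v) − χ(u,∞)| ≤ C/(|u| r²)`;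
* `ScatDecay.vDerivPoly`, `ScatDecay.vDerivCofactor` — `∂ᵥ^m P(1/r) = (δ^m P)(1/r)`,
  `δP = −P'·(X² − 2MX³)`, with `δ^m (X^j S) = X^{j+m} S_m` (so `|∂ᵥ^m V| ≤ K_m/r^{3+m}`);
* `ScatDecay.exists_iteratedDeriv_potential_mul` — `∂ᵥ^m (V f) = V f_m` with `f_m` in the bootstrap
  family, whence `∂ᵥ^m Ξ = ∫_{−∞}^{u} ∂ᵥ^m(Vχ)` (`ScatDecay.iteratedDeriv_uPrimitive`) and
  `∂ᵥ^{m+1} χ = H^{(m+1)} − ∫_{−∞}^{u} ∂ᵥ^m(Vχ)` (`ScatDecay.iteratedDeriv_succ_field`);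
* `ScatDecay.abs_iteratedDeriv_le` — **`|∂ᵥ^{b+1} χ(u,v)| ≤ C_b/(|u| r^{3+b})` on `{u ≤ U₀, v ≥ v₂}`**
  (induction on `b` with the Leibniz rule and the `U`-rule of `NonSmoothNullInfinityRegion.lean`),
  the input for the expansion (6.18) of `∂ᵥ(rφ)` towards `𝓘⁺`.

## References

* L. M. A. Kehrberger, *The case against smooth null infinity I*, Ann. Henri Poincaré 23 (2022)
  829–921 = arXiv:2105.08079 (v3, 2023), Thm. 4.2 (proof), Thm. 6.1 eq. (6.3), §6.2 footnote 55.
  Key `Kehrberger2022AHP`.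
-/

noncomputable section

open Set Filter Topology MeasureTheory intervalIntegral Function Asymptotics Polynomial

namespace Literature.Barriers.FinalStateConjecture

namespace ScatDecay

section Bootstrap

variable {M : ℝ} {r : ℝ → ℝ → ℝ} {v₁ v₂ U₀ A : ℝ} {H : ℝ → ℝ} {CH : ℝ}
variable (hr : IsEFAreaRadius M r) (hM : 0 < M)
  (hHd : ContDiff ℝ ((⊤ : ℕ∞) : WithTop ℕ∞) H) (hsupp : tsupport H ⊆ Ioo v₁ v₂)
  (hHb : ∀ v, |H v| ≤ CH) (hR : GoodRegion M r v₁ v₂ U₀ A)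
include hr hM hR

omit hr hM hR in
/-- `C_H ≥ 0`. [folklore] -/
lemma data_bound_nonneg (hHb : ∀ v, |H v| ≤ CH) : 0 ≤ CH := (abs_nonneg _).trans (hHb 0)

omit hr hM hR in
/-- The data vanish on `[v₂, ∞)`. [folklore] -/
lemma data_eq_zero_of_ge (hsupp : tsupport H ⊆ Ioo v₁ v₂) {v : ℝ} (hv : v₂ ≤ v) : H v = 0 :=
  eq_zero_of_tsupport_subset_Ioo hsupp (Or.inr hv)

omit hR in
/-- Continuity of the integrand `V · (χ − H)`. [folklore] -/
lemma continuous_potential_mul_sub :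
    Continuous (uncurry fun u v ↦ radialPotential M (r u v) *
      (scatteringField hr hM hHd.continuous hHb (data_eq_zero hsupp) u v - H v)) := by
  have h1 := continuous_potential hr hM
  have h2 := continuous_scatteringField hr hM hHd.continuous hHb (data_eq_zero hsupp)
  have h3 : Continuous (fun p : ℝ × ℝ ↦ H p.2) := hHd.continuous.comp continuous_snd
  exact h1.mul (h2.sub h3)

omit hR in
/-- Potential domination of the integrand `V · (χ − H)`. [folklore] -/
lemma isPotentialDominated_potential_mul_sub :
    IsPotentialDominated M r (fun u v ↦ radialPotential M (r u v) *
      (scatteringField hr hM hHd.continuous hHb (data_eq_zero hsupp) u v - H v)) := by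
  refine isPotentialDominated_potential_mul (M := M) (r := r) (fun V ↦ ?_)
    (fun u v ↦ (radialPotential_pos hM (hr.1 u v)).le)
  obtain ⟨B, hB⟩ := abs_scatteringField_le hr hM hHd.continuous hHb (data_eq_zero hsupp) V
  exact ⟨B + CH, fun u v hv ↦ (abs_sub _ _).trans (add_le_add (hB u v hv) (hHb v))⟩

omit hR in
/-- Continuity of the integrand `V · H`. [folklore] -/
lemma continuous_potential_mul_data (hHd : ContDiff ℝ ((⊤ : ℕ∞) : WithTop ℕ∞) H) :
    Continuous (uncurry fun u v ↦ radialPotential M (r u v) * H v) :=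
  (continuous_potential hr hM).mul (hHd.continuous.comp continuous_snd)

omit hR in
/-- Potential domination of the integrand `V · H`. [folklore] -/
lemma isPotentialDominated_potential_mul_data (hHb : ∀ v, |H v| ≤ CH) :
    IsPotentialDominated M r (fun u v ↦ radialPotential M (r u v) * H v) :=
  isPotentialDominated_potential_mul (M := M) (r := r) (f := fun _ v ↦ H v)
    (fun _ ↦ ⟨CH, fun _ v _ ↦ hHb v⟩) (fun u v ↦ (radialPotential_pos hM (hr.1 u v)).le)

omit hR in
/-- `∫_{−∞}^{u} V(u',v) H(v) du' = H(v) · M/r(u,v)²`. [folklore] -/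
lemma uPrimitive_potential_mul_data (u v : ℝ) :
    uPrimitive (fun u v ↦ radialPotential M (r u v) * H v) u v = H v * (M / r u v ^ 2) := by
  rw [uPrimitive_apply]
  simp_rw [mul_comm (radialPotential M _) (H v)]
  rw [MeasureTheory.integral_const_mul, hr.integral_potential_Iic hM u v]

omit hr hM hR in
/-- Restricting the strip to `{v₁}` keeps the region hypotheses. [folklore] -/
lemma _root_.Literature.Barriers.FinalStateConjecture.GoodRegion.toLeft
    (hR : GoodRegion M r v₁ v₂ U₀ A) (h12 : v₁ ≤ v₂) : GoodRegion M r v₁ v₁ U₀ A where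
  U₀_le := hR.U₀_le
  A_nonneg := hR.A_nonneg
  radius_ge := hR.radius_ge
  half_le := hR.half_le
  strip := fun u hu v hv ↦ hR.strip u hu v ⟨hv.1, hv.2.trans h12⟩
  log_small := hR.log_small

omit hR in
/-- **The splitting `Ξ = H · M/r² + R`** of `Ξ = ∫_{−∞}^{u} Vχ`, with `R = ∫_{−∞}^{u} V(χ − H)`.
[folklore] -/
theorem uPrimitive_eq (u v : ℝ) :
    uPrimitive (fun u v ↦ radialPotential M (r u v) *
        scatteringField hr hM hHd.continuous hHb (data_eq_zero hsupp) u v) u v =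
      H v * (M / r u v ^ 2) + uPrimitive (fun u v ↦ radialPotential M (r u v) *
        (scatteringField hr hM hHd.continuous hHb (data_eq_zero hsupp) u v - H v)) u v := by
  have hsum := uPrimitive_add hr hM (isPotentialDominated_potential_mul_data hr hM hHb)
    (continuous_potential_mul_data hr hM hHd)
    (isPotentialDominated_potential_mul_sub hr hM hHd hsupp hHb)
    (continuous_potential_mul_sub hr hM hHd hsupp hHb)
  have h := congrFun (congrFun hsum u) v
  rw [← uPrimitive_potential_mul_data hr hM (H := H) u v, ← h]
  congr 1
  funext u' v'
  ring

/-- **`|χ| ≤ 2 C_H` on `{u ≤ U₀}`** (all `v`). [folklore] -/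
theorem abs_le_two_mul {u : ℝ} (hu : u ≤ U₀) (v : ℝ) :
    |scatteringField hr hM hHd.continuous hHb (data_eq_zero hsupp) u v| ≤ 2 * CH :=
  abs_scatteringField_le_near_scri hr hM hHd.continuous hHb (data_eq_zero hsupp) hR.radius_ge hu v

/-- From a bound `|χ − H| ≤ b(u')` along the ray `u' ≤ u` (all `v`), monotone towards `u`:
`|R(u, v)| = |∫_{−∞}^{u} V(χ − H)| ≤ …` — the two rules used below, packaged: if
`|χ(u',v) − H(v)| ≤ K/|u'|` then `|R| ≤ 2MK/(|u| r²)` (`v ≥ v₁`), and if `|χ(u',v) − H(v)| ≤ K/u'²`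
then `|R| ≤ 2MK/(|u| r³)`. [folklore] -/
theorem abs_rem_le_of_inv {K u v : ℝ} (hu : u ≤ U₀) (hv : v₁ ≤ v)
    (hK : ∀ u', u' ≤ u → |scatteringField hr hM hHd.continuous hHb (data_eq_zero hsupp) u' v - H v| ≤
      K * (-u')⁻¹) :
    |uPrimitive (fun u v ↦ radialPotential M (r u v) *
        (scatteringField hr hM hHd.continuous hHb (data_eq_zero hsupp) u v - H v)) u v| ≤
      2 * M * K * ((-u)⁻¹ * (r u v ^ 2)⁻¹) := by
  have h := abs_uPrimitive_le_R hr hM hR (C := 2 * M * K) (a := 1) (b := 1) hu hv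
    (h := fun u v ↦ radialPotential M (r u v) *
      (scatteringField hr hM hHd.continuous hHb (data_eq_zero hsupp) u v - H v)) (fun u' hu' ↦ ?_)
  · refine h.trans (le_of_eq ?_)
    push_cast
    ring
  · have hp : 0 ≤ radialPotential M (r u' v) := (radialPotential_pos hM (hr.1 u' v)).le
    have hr0 : 0 < r u' v := hr.pos hM.le u' v
    have hu0 : 0 < -u' := by linarith [hR.U₀_le]
    rw [abs_mul, abs_of_nonneg hp]
    have hV : radialPotential M (r u' v) ≤ 2 * M / r u' v ^ 3 := radialPotential_le hM.le hr0
    calc radialPotential M (r u' v) * |scatteringField hr hM hHd.continuous hHb (data_eq_zero hsupp) u' v - H v|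
        ≤ (2 * M / r u' v ^ 3) * (K * (-u')⁻¹) :=
          mul_le_mul hV (hK u' hu') (abs_nonneg _) (by positivity)
      _ = 2 * M * K * (((-u') ^ 1)⁻¹ * (r u' v ^ (1 + 2))⁻¹) := by ring

/-- Second packaged rule: `|χ(u',v) − H(v)| ≤ K/u'²` along the ray gives `|R| ≤ 2MK/(|u| r³)`.
[folklore] -/
theorem abs_rem_le_of_sq {K u v : ℝ} (hu : u ≤ U₀)
    (hK : ∀ u', u' ≤ u → |scatteringField hr hM hHd.continuous hHb (data_eq_zero hsupp) u' v - H v| ≤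
      K * (u' ^ 2)⁻¹) :
    |uPrimitive (fun u v ↦ radialPotential M (r u v) *
        (scatteringField hr hM hHd.continuous hHb (data_eq_zero hsupp) u v - H v)) u v| ≤
      2 * M * K * ((-u)⁻¹ * (r u v ^ 3)⁻¹) := by
  have h := abs_uPrimitive_le_U hr hM hR (C := 2 * M * K) (a := 0) (b := 3) hu
    (h := fun u v ↦ radialPotential M (r u v) *
      (scatteringField hr hM hHd.continuous hHb (data_eq_zero hsupp) u v - H v)) (v := v)
      (fun u' hu' ↦ ?_)
  · refine h.trans (le_of_eq ?_)
    push_cast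
    ring
  · have hp : 0 ≤ radialPotential M (r u' v) := (radialPotential_pos hM (hr.1 u' v)).le
    have hr0 : 0 < r u' v := hr.pos hM.le u' v
    have hu0 : 0 < -u' := by linarith [hR.U₀_le]
    rw [abs_mul, abs_of_nonneg hp]
    have hV : radialPotential M (r u' v) ≤ 2 * M / r u' v ^ 3 := radialPotential_le hM.le hr0
    calc radialPotential M (r u' v) * |scatteringField hr hM hHd.continuous hHb (data_eq_zero hsupp) u' v - H v|
        ≤ (2 * M / r u' v ^ 3) * (K * (u' ^ 2)⁻¹) :=
          mul_le_mul hV (hK u' hu') (abs_nonneg _) (by positivity)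
      _ = 2 * M * K * (((-u') ^ (0 + 2))⁻¹ * (r u' v ^ 3)⁻¹) := by ring

omit hR in
/-- `χ − H = −∫_{v₁}^{v} Ξ`. [folklore] -/
lemma sub_data_eq (u v : ℝ) :
    scatteringField hr hM hHd.continuous hHb (data_eq_zero hsupp) u v - H v =
      -∫ v' in v₁..v, uPrimitive (fun u v ↦ radialPotential M (r u v) *
        scatteringField hr hM hHd.continuous hHb (data_eq_zero hsupp) u v) u v' := by
  rw [scatteringField_eq hr hM hHd.continuous hHb (data_eq_zero hsupp) u v, vPrimitive_apply]
  ring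

omit hR in
/-- `Ξ(u, ·)` is continuous. [folklore] -/
lemma continuous_uPrimitive_right (u : ℝ) :
    Continuous fun v ↦ uPrimitive (fun u v ↦ radialPotential M (r u v) *
      scatteringField hr hM hHd.continuous hHb (data_eq_zero hsupp) u v) u v :=
  (continuous_uPrimitive hr hM
    (isPotentialDominated_potential_mul_scatteringField hr hM hHd.continuous hHb (data_eq_zero hsupp))
    (continuous_potential_mul_scatteringField hr hM hHd.continuous hHb (data_eq_zero hsupp))).comp
    (Continuous.prodMk_right u)

omit hR in
/-- `R(u, ·)` is continuous. [folklore] -/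
lemma continuous_rem_right (u : ℝ) :
    Continuous fun v ↦ uPrimitive (fun u v ↦ radialPotential M (r u v) *
      (scatteringField hr hM hHd.continuous hHb (data_eq_zero hsupp) u v - H v)) u v :=
  (continuous_uPrimitive hr hM (isPotentialDominated_potential_mul_sub hr hM hHd hsupp hHb)
    (continuous_potential_mul_sub hr hM hHd hsupp hHb)).comp (Continuous.prodMk_right u)

/-- **First round: `|χ − H| ≤ 8 M C_H/|u|`** on `{u ≤ U₀}` (all `v`). [folklore] -/
theorem abs_sub_data_le_inv {u : ℝ} (hu : u ≤ U₀) (v : ℝ) :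
    |scatteringField hr hM hHd.continuous hHb (data_eq_zero hsupp) u v - H v| ≤ 8 * M * CH * (-u)⁻¹ := by
  have hCH := data_bound_nonneg hHb
  have hu0 : 0 < -u := hR.neg_pos hu
  rcases le_or_gt v v₁ with hv | hv
  · rw [scatteringField_eq_zero hr hM hHd.continuous hHb (data_eq_zero hsupp) hv, data_eq_zero hsupp v hv,
      sub_zero, abs_zero]
    positivity
  set χ := scatteringField hr hM hHd.continuous hHb (data_eq_zero hsupp) with hχ
  set Ξ : ℝ → ℝ → ℝ := uPrimitive (fun u v ↦ radialPotential M (r u v) * χ u v) with hΞ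
  -- `|Ξ(u, v')| ≤ 2 C_H M/r(u,v')²`
  have hΞb : ∀ v', |Ξ u v'| ≤ 2 * CH * (M / r u v' ^ 2) := by
    intro v'
    refine abs_uPrimitive_le_of_le hr hM fun u' hu' ↦ ?_
    have hp : 0 ≤ radialPotential M (r u' v') := (radialPotential_pos hM (hr.1 u' v')).le
    show |radialPotential M (r u' v') * χ u' v'| ≤ _
    rw [abs_mul, abs_of_nonneg hp, mul_comm]
    exact mul_le_mul_of_nonneg_right (abs_le_two_mul hr hM hHd hsupp hHb hR (hu'.trans hu) v') hp
  rw [sub_data_eq hr hM hHd hsupp hHb u v, abs_neg]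
  have h1 : |∫ v' in v₁..v, Ξ u v'| ≤ ∫ v' in v₁..v, 2 * CH * (M / r u v' ^ 2) := by
    have h := intervalIntegral.norm_integral_le_of_norm_le (μ := volume) hv.le
      (f := fun v' ↦ Ξ u v') (g := fun v' ↦ 2 * CH * (M / r u v' ^ 2))
      (Eventually.of_forall fun v' _ ↦ by rw [Real.norm_eq_abs]; exact hΞb v')
      (((continuous_div_sq_snd hr hM u).const_mul (2 * CH)).intervalIntegrable _ _)
    rwa [Real.norm_eq_abs] at h
  refine h1.trans ?_
  rw [intervalIntegral.integral_const_mul]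
  have h2 := integral_div_sq_le hr hM (hR.radius_ge u hu) hv.le
  have h3 : 2 * M / r u v₁ ≤ 2 * M * (2 / -u) := by
    rw [div_eq_mul_inv]
    exact mul_le_mul_of_nonneg_left (hR.inv_radius_le hr hM hu le_rfl) (by positivity)
  calc 2 * CH * ∫ v' in v₁..v, M / r u v' ^ 2 ≤ 2 * CH * (2 * M * (2 / -u)) :=
        mul_le_mul_of_nonneg_left (h2.trans h3) (by positivity)
    _ = 8 * M * CH * (-u)⁻¹ := by ring

/-- The data term of `∫_{v₁}^{v} Ξ`: `|∫_{v₁}^{v} H(v') M/r(u,v')² dv'| ≤ 4 M C_H (v₂ − v₁)/u²`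
(`v ≥ v₁`; the integrand lives on the strip `[v₁, v₂]`, where `1/r ≤ 2/|u|`). [folklore] -/
theorem abs_integral_data_mul_le (hHc : Continuous H) (hsupp : tsupport H ⊆ Ioo v₁ v₂)
    (hHb : ∀ v, |H v| ≤ CH) (h12 : v₁ ≤ v₂) {u v : ℝ} (hu : u ≤ U₀) (hv : v₁ ≤ v) :
    |∫ v' in v₁..v, H v' * (M / r u v' ^ 2)| ≤ 4 * M * CH * (v₂ - v₁) * (u ^ 2)⁻¹ := by
  have hCH := data_bound_nonneg hHb
  have hu0 : 0 < -u := hR.neg_pos hu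
  have hc : Continuous fun v' ↦ H v' * (M / r u v' ^ 2) :=
    hHc.mul (continuous_div_sq_snd hr hM u)
  -- pointwise bound on the strip
  have hpt : ∀ v' ∈ Icc v₁ v₂, |H v' * (M / r u v' ^ 2)| ≤ CH * (M * (2 / -u) ^ 2) := by
    intro v' hv'
    have hr0 : 0 < r u v' := hr.pos hM.le u v'
    rw [abs_mul, abs_of_nonneg (by positivity : 0 ≤ M / r u v' ^ 2)]
    refine mul_le_mul (hHb v') ?_ (by positivity) hCH
    rw [div_eq_mul_inv, ← inv_pow]
    exact mul_le_mul_of_nonneg_left (pow_le_pow_left₀ (by positivity)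
      (hR.inv_radius_le hr hM hu hv'.1) 2) hM.le
  -- reduce to the strip
  have hred : ∫ v' in v₁..v, H v' * (M / r u v' ^ 2) =
      ∫ v' in v₁..min v v₂, H v' * (M / r u v' ^ 2) := by
    rcases le_or_gt v v₂ with hv2 | hv2
    · rw [min_eq_left hv2]
    · rw [min_eq_right hv2.le, ← intervalIntegral.integral_add_adjacent_intervals (b := v₂)
        (hc.intervalIntegrable _ _) (hc.intervalIntegrable _ _)]
      have hz : ∫ v' in v₂..v, H v' * (M / r u v' ^ 2) = 0 := by
        rw [intervalIntegral.integral_congr (g := fun _ ↦ (0 : ℝ)) (fun v' hv' ↦ ?_)]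
        · simp
        · rw [uIcc_of_le hv2.le] at hv'
          simp [data_eq_zero_of_ge hsupp hv'.1]
      rw [hz, add_zero]
  rw [hred]
  have hle : v₁ ≤ min v v₂ := le_min hv h12
  have h := intervalIntegral.norm_integral_le_of_norm_le_const (a := v₁) (b := min v v₂)
    (C := CH * (M * (2 / -u) ^ 2)) (f := fun v' ↦ H v' * (M / r u v' ^ 2)) (fun v' hv' ↦ by
      rw [uIoc_of_le hle] at hv'
      rw [Real.norm_eq_abs]
      exact hpt v' ⟨hv'.1.le, hv'.2.trans (min_le_right _ _)⟩)
  rw [Real.norm_eq_abs] at h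
  refine h.trans ?_
  rw [abs_of_nonneg (by linarith)]
  have hlen : min v v₂ - v₁ ≤ v₂ - v₁ := by linarith [min_le_right v v₂]
  calc CH * (M * (2 / -u) ^ 2) * (min v v₂ - v₁) ≤ CH * (M * (2 / -u) ^ 2) * (v₂ - v₁) :=
        mul_le_mul_of_nonneg_left hlen (by positivity)
    _ = 4 * M * CH * (v₂ - v₁) * (u ^ 2)⁻¹ := by
        field_simp
        ring

/-- **Second round (eq. (6.3) at leading order): `|χ − H| ≤ B₂/u²`** on `{u ≤ U₀}` (all `v`), with
`B₂ = 4 M C_H (v₂ − v₁) + 64 M² C_H`. [cite: Kehrberger2022AHP, Thm. 6.1 eq. (6.3)] -/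
theorem abs_sub_data_le_sq (h12 : v₁ ≤ v₂) {u : ℝ} (hu : u ≤ U₀) (v : ℝ) :
    |scatteringField hr hM hHd.continuous hHb (data_eq_zero hsupp) u v - H v| ≤
      (4 * M * CH * (v₂ - v₁) + 64 * M ^ 2 * CH) * (u ^ 2)⁻¹ := by
  have hCH := data_bound_nonneg hHb
  have hu0 : 0 < -u := hR.neg_pos hu
  rcases le_or_gt v v₁ with hv | hv
  · rw [scatteringField_eq_zero hr hM hHd.continuous hHb (data_eq_zero hsupp) hv, data_eq_zero hsupp v hv,
      sub_zero, abs_zero]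
    positivity
  set χ := scatteringField hr hM hHd.continuous hHb (data_eq_zero hsupp) with hχ
  set R : ℝ → ℝ → ℝ := uPrimitive (fun u v ↦ radialPotential M (r u v) * (χ u v - H v)) with hRdef
  -- `|R(u, v')| ≤ 16 M² C_H/(|u| r²)` for `v' ≥ v₁`
  have hRb : ∀ v' ∈ Icc v₁ v, |R u v'| ≤ 16 * M ^ 2 * CH * (((-u) ^ 1)⁻¹ * (r u v' ^ (0 + 2))⁻¹) := by
    intro v' hv'
    have h := abs_rem_le_of_inv hr hM hHd hsupp hHb hR (K := 8 * M * CH) hu hv'.1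
      (fun u' hu' ↦ abs_sub_data_le_inv hr hM hHd hsupp hHb hR (hu'.trans hu) v')
    refine h.trans (le_of_eq ?_)
    ring
  have hc1 : Continuous fun v' ↦ H v' * (M / r u v' ^ 2) :=
    hHd.continuous.mul (continuous_div_sq_snd hr hM u)
  have hc2 : Continuous fun v' ↦ R u v' := continuous_rem_right hr hM hHd hsupp hHb u
  have hI : ∫ v' in v₁..v, uPrimitive (fun u v ↦ radialPotential M (r u v) * χ u v) u v' =
      (∫ v' in v₁..v, H v' * (M / r u v' ^ 2)) + ∫ v' in v₁..v, R u v' := by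
    rw [← intervalIntegral.integral_add (hc1.intervalIntegrable _ _) (hc2.intervalIntegrable _ _)]
    refine intervalIntegral.integral_congr fun v' _ ↦ ?_
    exact uPrimitive_eq hr hM hHd hsupp hHb u v'
  rw [sub_data_eq hr hM hHd hsupp hHb u v, abs_neg, hI]
  refine (abs_add_le _ _).trans ?_
  have h1 := abs_integral_data_mul_le hr hM hR hHd.continuous hsupp hHb h12 hu hv.le
  have h2 := abs_integral_right_le hr hM (hR.toLeft h12) (a := 1) (b := 0) hu le_rfl hv.le hRb
  refine (add_le_add h1 h2).trans ?_
  have hr1 : 0 < r u v₁ := hr.pos hM.le u v₁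
  have h4 : (r u v₁)⁻¹ ≤ 2 / -u := hR.inv_radius_le hr hM hu le_rfl
  have hkey : ((-u) ^ 1)⁻¹ * ((((0 : ℕ) : ℝ) + 1) * r u v₁ ^ (0 + 1))⁻¹ ≤ 2 * (u ^ 2)⁻¹ := by
    have : ((-u) ^ 1)⁻¹ * ((((0 : ℕ) : ℝ) + 1) * r u v₁ ^ (0 + 1))⁻¹ = (-u)⁻¹ * (r u v₁)⁻¹ := by
      norm_num
    rw [this]
    calc (-u)⁻¹ * (r u v₁)⁻¹ ≤ (-u)⁻¹ * (2 / -u) :=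
          mul_le_mul_of_nonneg_left h4 (by positivity)
      _ = 2 * (u ^ 2)⁻¹ := by field_simp
  have : 2 * (16 * M ^ 2 * CH) * (((-u) ^ 1)⁻¹ * ((((0 : ℕ) : ℝ) + 1) * r u v₁ ^ (0 + 1))⁻¹) ≤
      64 * M ^ 2 * CH * (u ^ 2)⁻¹ := by
    calc 2 * (16 * M ^ 2 * CH) * (((-u) ^ 1)⁻¹ * ((((0 : ℕ) : ℝ) + 1) * r u v₁ ^ (0 + 1))⁻¹)
        ≤ 2 * (16 * M ^ 2 * CH) * (2 * (u ^ 2)⁻¹) := mul_le_mul_of_nonneg_left hkey (by positivity)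
      _ = 64 * M ^ 2 * CH * (u ^ 2)⁻¹ := by ring
  nlinarith [this]

/-- The `u²`-round constant `B₂ = 4 M C_H (v₂ − v₁) + 64 M² C_H` of `abs_sub_data_le_sq`. [folklore] -/
def sqConst (M CH v₁ v₂ : ℝ) : ℝ := 4 * M * CH * (v₂ - v₁) + 64 * M ^ 2 * CH

omit hr hM hR in
/-- `B₂ ≥ 0` (`v₁ ≤ v₂`, `M > 0`). [folklore] -/
lemma sqConst_nonneg (hM : 0 < M) (hHb : ∀ v, |H v| ≤ CH) (h12 : v₁ ≤ v₂) : 0 ≤ sqConst M CH v₁ v₂ := by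
  have := data_bound_nonneg hHb
  unfold sqConst
  have : 0 ≤ v₂ - v₁ := by linarith
  positivity

/-- `abs_sub_data_le_sq` in terms of `sqConst`. [folklore] -/
theorem abs_sub_data_le_sqConst (h12 : v₁ ≤ v₂) {u : ℝ} (hu : u ≤ U₀) (v : ℝ) :
    |scatteringField hr hM hHd.continuous hHb (data_eq_zero hsupp) u v - H v| ≤
      sqConst M CH v₁ v₂ * (u ^ 2)⁻¹ :=
  abs_sub_data_le_sq hr hM hHd hsupp hHb hR h12 hu v

/-- **Third round, the remainder: `|R(u, v)| ≤ 2 M B₂/(|u| r³)`** on `{u ≤ U₀}` (all `v`), by the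
`U`-rule. [folklore] -/
theorem abs_rem_le (h12 : v₁ ≤ v₂) {u : ℝ} (hu : u ≤ U₀) (v : ℝ) :
    |uPrimitive (fun u v ↦ radialPotential M (r u v) *
        (scatteringField hr hM hHd.continuous hHb (data_eq_zero hsupp) u v - H v)) u v| ≤
      2 * M * sqConst M CH v₁ v₂ * ((-u)⁻¹ * (r u v ^ 3)⁻¹) :=
  abs_rem_le_of_sq hr hM hHd hsupp hHb hR hu fun _ hu' ↦
    abs_sub_data_le_sqConst hr hM hHd hsupp hHb hR h12 (hu'.trans hu) v

/-- `|∫_{a}^{v} R(u, v') dv'| ≤ 2 M B₂/(|u| r(u,a)²)` for `v₁ ≤ a ≤ v` (outgoing rule). [folklore] -/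
theorem abs_integral_rem_le (h12 : v₁ ≤ v₂) {u a v : ℝ} (hu : u ≤ U₀) (ha : v₁ ≤ a) (hv : a ≤ v) :
    |∫ v' in a..v, uPrimitive (fun u v ↦ radialPotential M (r u v) *
        (scatteringField hr hM hHd.continuous hHb (data_eq_zero hsupp) u v - H v)) u v'| ≤
      2 * M * sqConst M CH v₁ v₂ * ((-u)⁻¹ * (r u a ^ 2)⁻¹) := by
  -- the region with strip `[v₁, a]` is again good enough for the outgoing rule from `a`:
  -- we only need `radius_ge`/`half_le`, so use the rule of the restricted region `toLeft`
  -- transported along `v₁ ≤ a` by monotonicity of `r` in `v`.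
  have hB : ∀ v' ∈ Icc a v, |uPrimitive (fun u v ↦ radialPotential M (r u v) *
      (scatteringField hr hM hHd.continuous hHb (data_eq_zero hsupp) u v - H v)) u v'| ≤
      2 * M * sqConst M CH v₁ v₂ * (((-u) ^ 1)⁻¹ * (r u v' ^ (1 + 2))⁻¹) := fun v' _ ↦ by
    simpa using abs_rem_le hr hM hHd hsupp hHb hR h12 hu v'
  -- outgoing rule for the region `GoodRegion M r v₁ a U₀ A'`? We avoid building it: integrate the
  -- bound `C |u|⁻¹ r^{-3}` directly with `integral_right_radius_inv_pow` of the `toLeft` region,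
  -- after shifting the lower limit from `v₁` to `a` by positivity of the integrand bound.
  have hu0 : 0 < -u := hR.neg_pos hu
  have hC : 0 ≤ 2 * M * sqConst M CH v₁ v₂ := by
    have := sqConst_nonneg (v₁ := v₁) (v₂ := v₂) hM hHb h12; positivity
  have hc : Continuous fun v' ↦ (r u v' ^ (1 + 2))⁻¹ :=
    ((hr.continuous_snd u).pow _).inv₀ fun v' ↦ pow_ne_zero _ (hr.pos hM.le u v').ne'
  have h1 : |∫ v' in a..v, uPrimitive (fun u v ↦ radialPotential M (r u v) *
        (scatteringField hr hM hHd.continuous hHb (data_eq_zero hsupp) u v - H v)) u v'| ≤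
      ∫ v' in a..v, 2 * M * sqConst M CH v₁ v₂ * ((-u) ^ 1)⁻¹ * (r u v' ^ (1 + 2))⁻¹ := by
    have h := intervalIntegral.norm_integral_le_of_norm_le (μ := volume) hv
      (f := fun v' ↦ uPrimitive (fun u v ↦ radialPotential M (r u v) *
        (scatteringField hr hM hHd.continuous hHb (data_eq_zero hsupp) u v - H v)) u v')
      (g := fun v' ↦ 2 * M * sqConst M CH v₁ v₂ * ((-u) ^ 1)⁻¹ * (r u v' ^ (1 + 2))⁻¹)
      (Eventually.of_forall fun v' hv' ↦ by
        rw [Real.norm_eq_abs]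
        have := hB v' ⟨hv'.1.le, hv'.2⟩
        simpa [mul_assoc] using this)
      ((hc.const_mul _).intervalIntegrable _ _)
    rwa [Real.norm_eq_abs] at h
  refine h1.trans ?_
  rw [intervalIntegral.integral_const_mul]
  -- `∫_a^v r^{-3} ≤ ∫_{v₁}^{v} r^{-3}`-type bound is not needed: integrate exactly as in the rule
  have hderiv : ∀ x : ℝ, HasDerivAt (fun v' ↦ -(((1 : ℝ) + 1) * r u v' ^ (1 + 1))⁻¹)
      ((1 - 2 * M / r u x) / r u x ^ (1 + 2)) x := by
    intro x
    have hx : r u x ≠ 0 := (hr.pos hM.le u x).ne'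
    have hc' : HasDerivAt (fun v' : ℝ ↦ ((1 : ℝ) + 1) * r u v' ^ (1 + 1))
        (((1 : ℝ) + 1) * (((1 + 1 : ℕ) : ℝ) * r u x ^ (1 + 1 - 1) * (1 - 2 * M / r u x))) x :=
      ((hr.2.1 u x).pow (1 + 1)).const_mul _
    have h := (hc'.inv (mul_ne_zero (by norm_num) (pow_ne_zero _ hx))).neg
    refine h.congr_deriv ?_
    simp only [Nat.cast_add, Nat.cast_one, Nat.add_sub_cancel]
    field_simp
    ring
  have hcx : Continuous (fun x ↦ r u x) := hr.continuous_snd u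
  have hne : ∀ x, r u x ≠ 0 := fun x ↦ (hr.pos hM.le u x).ne'
  have hcg' : Continuous fun x ↦ (1 - 2 * M / r u x) / r u x ^ (1 + 2) :=
    (continuous_const.sub (continuous_const.div hcx hne)).div (hcx.pow _)
      fun x ↦ pow_ne_zero _ (hne x)
  have hhalf : ∀ v' ∈ Icc a v, (r u v' ^ (1 + 2))⁻¹ ≤ 2 * ((1 - 2 * M / r u v') / r u v' ^ (1 + 2)) := by
    intro v' hv'
    have hf := hR.factor_ge_half hr hM hu (ha.trans hv'.1)
    have h0 : 0 < r u v' ^ (1 + 2) := pow_pos (hr.pos hM.le u v') _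
    rw [div_eq_mul_inv]
    nlinarith [inv_pos.2 h0]
  have hI2 : ∫ v' in a..v, (r u v' ^ (1 + 2))⁻¹ ≤
      ∫ v' in a..v, 2 * ((1 - 2 * M / r u v') / r u v' ^ (1 + 2)) :=
    intervalIntegral.integral_mono_on hv (hc.intervalIntegrable _ _)
      ((hcg'.const_mul 2).intervalIntegrable _ _) hhalf
  have hval : ∫ v' in a..v, 2 * ((1 - 2 * M / r u v') / r u v' ^ (1 + 2)) =
      2 * (-(((1 : ℝ) + 1) * r u v ^ (1 + 1))⁻¹ - -(((1 : ℝ) + 1) * r u a ^ (1 + 1))⁻¹) := by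
    rw [intervalIntegral.integral_const_mul,
      intervalIntegral.integral_eq_sub_of_hasDerivAt (fun x _ ↦ hderiv x) (hcg'.intervalIntegrable _ _)]
  have hra : 0 < r u a := hr.pos hM.le u a
  have hrv : 0 < r u v := hr.pos hM.le u v
  have hI3 : ∫ v' in a..v, (r u v' ^ (1 + 2))⁻¹ ≤ (r u a ^ 2)⁻¹ := by
    refine (hI2.trans_eq hval).trans ?_
    have hx : 0 < (r u v ^ 2)⁻¹ := by positivity
    norm_num
    nlinarith [hx]
  calc 2 * M * sqConst M CH v₁ v₂ * ((-u) ^ 1)⁻¹ * ∫ v' in a..v, (r u v' ^ (1 + 2))⁻¹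
      ≤ 2 * M * sqConst M CH v₁ v₂ * ((-u) ^ 1)⁻¹ * (r u a ^ 2)⁻¹ :=
        mul_le_mul_of_nonneg_left hI3 (by positivity)
    _ = 2 * M * sqConst M CH v₁ v₂ * ((-u)⁻¹ * (r u a ^ 2)⁻¹) := by ring

/-- The constant of the logarithmic error in `abs_add_moment_le`. [folklore] -/
def logConst (M CH v₁ v₂ A : ℝ) : ℝ := 32 * M * CH * (v₂ - v₁) * A + 8 * M * sqConst M CH v₁ v₂

/-- **Kehrberger's (6.3)/(6.17) at order `n = 0`, for the constructed field:
`|χ(u, v) + M (∫H)/u²| ≤ C log|u|/|u|³` on `{u ≤ U₀, v ≥ v₂}`** (EF gauge: the `O(|u|⁻³)` of (6.3)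
becomes `O(|u|⁻³ log|u|)`, §6.2 footnote 55). Proof: `χ = −∫_{v₁}^{v₂} H M/r² − ∫_{v₁}^{v} R` with
`|1/r² − 1/u²| ≤ 32 A log|u|/|u|³` on the strip and `|∫ R| ≤ 2MB₂/(|u| r(u,v₁)²) ≤ 8MB₂/|u|³`.
[cite: Kehrberger2022AHP, Thm. 6.1 eq. (6.3) and §6.2 footnote 55] -/
theorem abs_add_moment_le (h12 : v₁ ≤ v₂) {u : ℝ} (hu : u ≤ U₀) {v : ℝ} (hv : v₂ ≤ v) :
    |scatteringField hr hM hHd.continuous hHb (data_eq_zero hsupp) u v +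
        M * (∫ v' in v₁..v₂, H v') * (u ^ 2)⁻¹| ≤
      logConst M CH v₁ v₂ A * Real.log (-u) * ((-u) ^ 3)⁻¹ := by
  have hCH := data_bound_nonneg hHb
  have hu0 : 0 < -u := hR.neg_pos hu
  have hlog := hR.one_le_log hu
  have hA := hR.A_nonneg
  have hB2 := sqConst_nonneg (v₁ := v₁) (v₂ := v₂) hM hHb h12
  set χ := scatteringField hr hM hHd.continuous hHb (data_eq_zero hsupp) with hχ
  set R : ℝ → ℝ → ℝ := uPrimitive (fun u v ↦ radialPotential M (r u v) * (χ u v - H v)) with hRdef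
  have hv1 : v₁ ≤ v := h12.trans hv
  have hc1 : Continuous fun v' ↦ H v' * (M / r u v' ^ 2) :=
    hHd.continuous.mul (continuous_div_sq_snd hr hM u)
  have hc2 : Continuous fun v' ↦ R u v' := continuous_rem_right hr hM hHd hsupp hHb u
  -- `χ(u,v) = −∫_{v₁}^{v} (H M/r² + R)`
  have hχeq : χ u v = -((∫ v' in v₁..v, H v' * (M / r u v' ^ 2)) + ∫ v' in v₁..v, R u v') := by
    have h : χ u v - H v = -∫ v' in v₁..v, uPrimitive (fun u v ↦ radialPotential M (r u v) * χ u v) u v' :=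
      sub_data_eq hr hM hHd hsupp hHb u v
    rw [data_eq_zero_of_ge hsupp hv, sub_zero] at h
    rw [h, ← intervalIntegral.integral_add (hc1.intervalIntegrable _ _) (hc2.intervalIntegrable _ _)]
    congr 1
    refine intervalIntegral.integral_congr fun v' _ ↦ ?_
    exact uPrimitive_eq hr hM hHd hsupp hHb u v'
  -- the data integral lives on `[v₁, v₂]`
  have hdat : ∫ v' in v₁..v, H v' * (M / r u v' ^ 2) = ∫ v' in v₁..v₂, H v' * (M / r u v' ^ 2) := by
    rw [← intervalIntegral.integral_add_adjacent_intervals (b := v₂)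
      (hc1.intervalIntegrable _ _) (hc1.intervalIntegrable _ _)]
    have hz : ∫ v' in v₂..v, H v' * (M / r u v' ^ 2) = 0 := by
      rw [intervalIntegral.integral_congr (g := fun _ ↦ (0 : ℝ)) (fun v' hv' ↦ ?_)]
      · simp
      · rw [uIcc_of_le hv] at hv'
        simp [data_eq_zero_of_ge hsupp hv'.1]
    rw [hz, add_zero]
  -- split off `M/u² ∫ H`
  have hc3 : Continuous fun v' ↦ H v' * (M * ((r u v' ^ 2)⁻¹ - ((-u) ^ 2)⁻¹)) :=
    hHd.continuous.mul (continuous_const.mul ((((hr.continuous_snd u).pow 2).inv₀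
      fun v' ↦ pow_ne_zero _ (hr.pos hM.le u v').ne').sub continuous_const))
  have hc4 : Continuous fun v' ↦ H v' * (M * ((-u) ^ 2)⁻¹) := hHd.continuous.mul continuous_const
  have hsplit : ∫ v' in v₁..v₂, H v' * (M / r u v' ^ 2) =
      (∫ v' in v₁..v₂, H v' * (M * ((r u v' ^ 2)⁻¹ - ((-u) ^ 2)⁻¹))) +
        M * (∫ v' in v₁..v₂, H v') * (u ^ 2)⁻¹ := by
    rw [show M * (∫ v' in v₁..v₂, H v') * (u ^ 2)⁻¹ = ∫ v' in v₁..v₂, H v' * (M * ((-u) ^ 2)⁻¹) by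
      rw [intervalIntegral.integral_mul_const]; ring,
      ← intervalIntegral.integral_add (hc3.intervalIntegrable _ _) (hc4.intervalIntegrable _ _)]
    refine intervalIntegral.integral_congr fun v' _ ↦ ?_
    simp only [div_eq_mul_inv]
    ring
  have hkey : χ u v + M * (∫ v' in v₁..v₂, H v') * (u ^ 2)⁻¹ =
      -(∫ v' in v₁..v₂, H v' * (M * ((r u v' ^ 2)⁻¹ - ((-u) ^ 2)⁻¹))) - ∫ v' in v₁..v, R u v' := by
    rw [hχeq, hdat, hsplit]; ring
  rw [hkey]
  refine (abs_sub _ _).trans ?_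
  rw [abs_neg]
  -- the strip term
  have hstrip : |∫ v' in v₁..v₂, H v' * (M * ((r u v' ^ 2)⁻¹ - ((-u) ^ 2)⁻¹))| ≤
      32 * M * CH * (v₂ - v₁) * A * Real.log (-u) * ((-u) ^ 3)⁻¹ := by
    have h := intervalIntegral.norm_integral_le_of_norm_le_const (a := v₁) (b := v₂)
      (C := CH * (M * (2 * 4 ^ 2 * A * Real.log (-u) / (-u) ^ (2 + 1))))
      (f := fun v' ↦ H v' * (M * ((r u v' ^ 2)⁻¹ - ((-u) ^ 2)⁻¹))) (fun v' hv' ↦ by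
        rw [uIoc_of_le h12] at hv'
        rw [Real.norm_eq_abs, abs_mul, abs_mul, abs_of_pos hM]
        refine mul_le_mul (hHb v') (mul_le_mul_of_nonneg_left ?_ hM.le) (by positivity) hCH
        have := abs_inv_radius_pow_sub_le hr hM hR 2 hu ⟨hv'.1.le, hv'.2⟩
        exact_mod_cast this)
    rw [Real.norm_eq_abs] at h
    refine h.trans (le_of_eq ?_)
    rw [abs_of_nonneg (by linarith)]
    ring
  -- the remainder term
  have hrem : |∫ v' in v₁..v, R u v'| ≤ 8 * M * sqConst M CH v₁ v₂ * Real.log (-u) * ((-u) ^ 3)⁻¹ := by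
    have h := abs_integral_rem_le hr hM hHd hsupp hHb hR h12 hu le_rfl hv1
    refine h.trans ?_
    have h4 : (r u v₁)⁻¹ ≤ 2 / -u := hR.inv_radius_le hr hM hu le_rfl
    have hr1 : 0 < r u v₁ := hr.pos hM.le u v₁
    have h5 : (r u v₁ ^ 2)⁻¹ ≤ (2 / -u) ^ 2 := by
      rw [← inv_pow]; exact pow_le_pow_left₀ (by positivity) h4 2
    calc 2 * M * sqConst M CH v₁ v₂ * ((-u)⁻¹ * (r u v₁ ^ 2)⁻¹)
        ≤ 2 * M * sqConst M CH v₁ v₂ * ((-u)⁻¹ * (2 / -u) ^ 2) :=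
          mul_le_mul_of_nonneg_left (mul_le_mul_of_nonneg_left h5 (by positivity)) (by positivity)
      _ = 8 * M * sqConst M CH v₁ v₂ * 1 * ((-u) ^ 3)⁻¹ := by field_simp; ring
      _ ≤ 8 * M * sqConst M CH v₁ v₂ * Real.log (-u) * ((-u) ^ 3)⁻¹ :=
          mul_le_mul_of_nonneg_right (mul_le_mul_of_nonneg_left hlog (by positivity)) (by positivity)
  refine (add_le_add hstrip hrem).trans (le_of_eq ?_)
  unfold logConst
  ring

end Bootstrap

/-! ### The class-level statement at order `n = 0` -/

/-- **Kehrberger's `|u|`-decay (6.17) at order `n = 0` (Thm. 6.1, eq. (6.3), in the EF gauge of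
§6.2)**: for every scattering solution `ψ` with smooth data `G` supported in `(v₁, v₂)` there are
`U₀ < −1` and `C` with `|ψ(u,v) + I⁽⁰⁾[G]/|u|²| ≤ C log|u|/|u|³` for `u < U₀`, `v ≥ v₂`
(`I⁽⁰⁾[G] = M∫G`). This is the case `n = 0` of the named fact `SchwarzschildLinearScattering_uDecay`.
[cite: Kehrberger2022AHP, Thm. 6.1 eq. (6.3), Thm. 6.2 eq. (6.17) (n = 0), §6.2 footnote 55] -/
theorem _root_.Literature.Barriers.FinalStateConjecture.SchwarzschildLinearScattering_uDecay_zero :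
    ∀ (M : ℝ), 0 < M → ∀ (r : ℝ → ℝ → ℝ), IsEFAreaRadius M r →
    ∀ (G : ℝ → ℝ) (v₁ v₂ : ℝ), v₁ < v₂ → ContDiff ℝ ((⊤ : ℕ∞) : WithTop ℕ∞) G →
      tsupport G ⊆ Ioo v₁ v₂ →
    ∀ (ψ : ℝ → ℝ → ℝ), IsScatteringSolution M r v₁ G ψ →
      ∃ U₀ : ℝ, U₀ < -1 ∧ ∃ C : ℝ, ∀ u, u < U₀ → ∀ v, v₂ ≤ v →
        |ψ u v + kehrbergerMoment M G 0 / |u| ^ 2| ≤ C * Real.log |u| / |u| ^ 3 := by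
  intro M hM r hr G v₁ v₂ h12 hG hsupp ψ hψ
  obtain ⟨CG, hGb⟩ := exists_bound_of_tsupport hG.continuous hsupp
  have hsol := isScatteringSolution_scatteringField hr hM hG hsupp hGb
  have e := SchwarzschildLinearScattering_unique_holds M hM r hr G v₁ _ _ hψ hsol
  subst e
  obtain ⟨U₀, A, hU₀, hR⟩ := exists_goodRegion hr hM v₁ v₂
  refine ⟨U₀, hU₀, logConst M CG v₁ v₂ A, fun u hu v hv ↦ ?_⟩
  have h := abs_add_moment_le hr hM hG hsupp hGb hR h12.le hu.le hv
  have hu0 : 0 < -u := hR.neg_pos hu.le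
  have habs : |u| = -u := abs_of_neg (by linarith)
  have hmom : kehrbergerMoment M G 0 = M * ∫ v' in v₁..v₂, G v' := by
    rw [kehrbergerMoment_zero, ← scatteringTimeIntegral_eq_integral_of_le hsupp le_rfl,
      scatteringTimeIntegral_apply]
  rw [habs, hmom]
  have hu2 : |u| ^ 2 = u ^ 2 := by rw [habs]; ring
  calc |scatteringField hr hM hG.continuous hGb (data_eq_zero hsupp) u v + M * (∫ v' in v₁..v₂, G v') / (-u) ^ 2|
      = |scatteringField hr hM hG.continuous hGb (data_eq_zero hsupp) u v +
          M * (∫ v' in v₁..v₂, G v') * (u ^ 2)⁻¹| := by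
        congr 1; rw [div_eq_mul_inv, neg_sq]
    _ ≤ logConst M CG v₁ v₂ A * Real.log (-u) * ((-u) ^ 3)⁻¹ := h
    _ = logConst M CG v₁ v₂ A * Real.log (-u) / (-u) ^ 3 := by rw [div_eq_mul_inv]

/-! ### The limit on `𝓘⁺` -/

section FutureLimit

variable {M : ℝ} {r : ℝ → ℝ → ℝ} {v₁ v₂ U₀ A : ℝ} {H : ℝ → ℝ} {CH : ℝ}
variable (hr : IsEFAreaRadius M r) (hM : 0 < M)
  (hHd : ContDiff ℝ ((⊤ : ℕ∞) : WithTop ℕ∞) H) (hsupp : tsupport H ⊆ Ioo v₁ v₂)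
  (hHb : ∀ v, |H v| ≤ CH) (hR : GoodRegion M r v₁ v₂ U₀ A)
include hr hM hR

/-- `χ(u, ·) → χ(u, ∞) = scatFutureLimit … u` as `v → ∞`, for `u ≤ U₀`. [folklore] -/
theorem tendsto_futureLimit {u : ℝ} (hu : u ≤ U₀) :
    Tendsto (fun v ↦ scatteringField hr hM hHd.continuous hHb (data_eq_zero hsupp) u v) atTop
      (𝓝 (scatFutureLimit M r v₁ (scatteringField hr hM hHd.continuous hHb (data_eq_zero hsupp)) u)) :=
  tendsto_scatFutureLimit hr hM (scatBootstrap_scatteringField hr hM hHd hsupp hHb) hsupp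
    (fun _ hu v ↦ abs_le_two_mul hr hM hHd hsupp hHb hR hu v)
    (scatteringField_eq hr hM hHd.continuous hHb (data_eq_zero hsupp)) hu

/-- **(6.17) at `n = 0` on `𝓘⁺`: `|χ(u, ∞) + M(∫H)/u²| ≤ C log|u|/|u|³`** for `u ≤ U₀`.
[cite: Kehrberger2022AHP, Thm. 6.1 eq. (6.3)] -/
theorem abs_futureLimit_add_moment_le (h12 : v₁ ≤ v₂) {u : ℝ} (hu : u ≤ U₀) :
    |scatFutureLimit M r v₁ (scatteringField hr hM hHd.continuous hHb (data_eq_zero hsupp)) u +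
        M * (∫ v' in v₁..v₂, H v') * (u ^ 2)⁻¹| ≤
      logConst M CH v₁ v₂ A * Real.log (-u) * ((-u) ^ 3)⁻¹ := by
  have ht := ((tendsto_futureLimit hr hM hHd hsupp hHb hR hu).add_const
    (M * (∫ v' in v₁..v₂, H v') * (u ^ 2)⁻¹)).abs
  refine le_of_tendsto ht ?_
  filter_upwards [eventually_ge_atTop v₂] with v hv
  exact abs_add_moment_le hr hM hHd hsupp hHb hR h12 hu hv

omit hR in
/-- For `v₂ ≤ v ≤ w`: `χ(u, w) − χ(u, v) = −∫_v^w R(u, v') dv'` (the data term of `Ξ` is absent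
beyond `v₂`). [folklore] -/
lemma sub_eq_neg_integral_rem {u v w : ℝ} (hv : v₂ ≤ v) (hw : v ≤ w) :
    scatteringField hr hM hHd.continuous hHb (data_eq_zero hsupp) u w -
        scatteringField hr hM hHd.continuous hHb (data_eq_zero hsupp) u v =
      -∫ v' in v..w, uPrimitive (fun u v ↦ radialPotential M (r u v) *
        (scatteringField hr hM hHd.continuous hHb (data_eq_zero hsupp) u v - H v)) u v' := by
  set χ := scatteringField hr hM hHd.continuous hHb (data_eq_zero hsupp) with hχ
  have hc : Continuous fun v' ↦ uPrimitive (fun u v ↦ radialPotential M (r u v) * χ u v) u v' :=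
    continuous_uPrimitive_right hr hM hHd hsupp hHb u
  have hw' : χ u w = H w - vPrimitive v₁ (uPrimitive fun u v ↦ radialPotential M (r u v) * χ u v) u w :=
    scatteringField_eq hr hM hHd.continuous hHb (data_eq_zero hsupp) u w
  have hv' : χ u v = H v - vPrimitive v₁ (uPrimitive fun u v ↦ radialPotential M (r u v) * χ u v) u v :=
    scatteringField_eq hr hM hHd.continuous hHb (data_eq_zero hsupp) u v
  have h1 : χ u w - χ u v = -∫ v' in v..w, uPrimitive (fun u v ↦ radialPotential M (r u v) * χ u v) u v' := by
    rw [hw', hv', vPrimitive_apply, vPrimitive_apply, data_eq_zero_of_ge hsupp hv,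
      data_eq_zero_of_ge hsupp (hv.trans hw), zero_sub, zero_sub, neg_sub_neg,
      intervalIntegral.integral_interval_sub_left (hc.intervalIntegrable _ _) (hc.intervalIntegrable _ _),
      intervalIntegral.integral_symm]
  rw [h1]
  congr 1
  refine intervalIntegral.integral_congr fun v' hv' ↦ ?_
  rw [uIcc_of_le hw] at hv'
  have h : uPrimitive (fun u v ↦ radialPotential M (r u v) * χ u v) u v' =
      H v' * (M / r u v' ^ 2) + uPrimitive (fun u v ↦ radialPotential M (r u v) * (χ u v - H v)) u v' :=
    uPrimitive_eq hr hM hHd hsupp hHb u v'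
  rw [h, data_eq_zero_of_ge hsupp (hv.trans hv'.1), zero_mul, zero_add]

/-- **`|χ(u, v) − χ(u, ∞)| ≤ 2 M B₂/(|u| r(u,v)²)` on `{u ≤ U₀, v ≥ v₂}`.** [folklore] -/
theorem abs_sub_futureLimit_le (h12 : v₁ ≤ v₂) {u : ℝ} (hu : u ≤ U₀) {v : ℝ} (hv : v₂ ≤ v) :
    |scatteringField hr hM hHd.continuous hHb (data_eq_zero hsupp) u v -
        scatFutureLimit M r v₁ (scatteringField hr hM hHd.continuous hHb (data_eq_zero hsupp)) u| ≤
      2 * M * sqConst M CH v₁ v₂ * ((-u)⁻¹ * (r u v ^ 2)⁻¹) := by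
  have ht := ((tendsto_futureLimit hr hM hHd hsupp hHb hR hu).const_sub
    (scatteringField hr hM hHd.continuous hHb (data_eq_zero hsupp) u v)).abs
  refine le_of_tendsto ht ?_
  filter_upwards [eventually_ge_atTop v] with w hw
  rw [abs_sub_comm, sub_eq_neg_integral_rem hr hM hHd hsupp hHb hv hw, abs_neg]
  exact abs_integral_rem_le hr hM hHd hsupp hHb hR h12 hu (h12.trans hv) hw

/-- `|χ(u, ∞)| ≤ B₂/u²` for `u ≤ U₀`. [folklore] -/
theorem abs_futureLimit_le (h12 : v₁ ≤ v₂) {u : ℝ} (hu : u ≤ U₀) :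
    |scatFutureLimit M r v₁ (scatteringField hr hM hHd.continuous hHb (data_eq_zero hsupp)) u| ≤
      sqConst M CH v₁ v₂ * (u ^ 2)⁻¹ := by
  refine le_of_tendsto (tendsto_futureLimit hr hM hHd hsupp hHb hR hu).abs ?_
  filter_upwards [eventually_ge_atTop v₂] with v hv
  have h := abs_sub_data_le_sqConst hr hM hHd hsupp hHb hR h12 hu v
  rwa [data_eq_zero_of_ge hsupp hv, sub_zero] at h

/-- `u ↦ χ(u, ∞)` is smooth on `(−∞, U₀)`. [folklore] -/
theorem contDiffOn_futureLimit :
    ContDiffOn ℝ ((⊤ : ℕ∞) : WithTop ℕ∞)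
      (scatFutureLimit M r v₁ (scatteringField hr hM hHd.continuous hHb (data_eq_zero hsupp))) (Iio U₀) :=
  contDiffOn_scatFutureLimit hr hM (scatBootstrap_scatteringField hr hM hHd hsupp hHb) hsupp
    (fun _ hu v ↦ abs_le_two_mul hr hM hHd hsupp hHb hR hu v)

end FutureLimit

end ScatDecay

/-! ### `v`-derivatives of polynomials in `1/r` -/

namespace ScatDecay

section VDerivPoly

variable {M : ℝ} {r : ℝ → ℝ → ℝ} (hr : IsEFAreaRadius M r) (hM : 0 < M)

/-- `δP := −P' · (X² − 2M X³)`: the polynomial with `∂ᵥ P(1/r) = (δP)(1/r)`. [folklore] -/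
def vDerivPoly (M : ℝ) (P : ℝ[X]) : ℝ[X] := -(derivative P * invRadiusDerivPoly M)

include hr hM in
/-- `∂ᵥ P(1/r) = (δP)(1/r)`. [folklore] -/
lemma hasDerivAt_eval_invRadius_vDerivPoly (P : ℝ[X]) (u v : ℝ) :
    HasDerivAt (fun v' ↦ P.eval (r u v')⁻¹) ((vDerivPoly M P).eval (r u v)⁻¹) v := by
  have h := hasDerivAt_eval_invRadius_right hr hM P u v
  simpa [vDerivPoly] using h

include hr hM in
/-- **`∂ᵥ^m P(1/r) = (δ^m P)(1/r)`.** [folklore] -/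
theorem iteratedDeriv_eval_invRadius (P : ℝ[X]) (m : ℕ) (u v : ℝ) :
    iteratedDeriv m (fun v' ↦ P.eval (r u v')⁻¹) v = ((vDerivPoly M)^[m] P).eval (r u v)⁻¹ := by
  induction m generalizing P v with
  | zero => simp
  | succ m ih =>
    rw [iteratedDeriv_succ', Function.iterate_succ_apply]
    have hd : deriv (fun v' ↦ P.eval (r u v')⁻¹) = fun v' ↦ (vDerivPoly M P).eval (r u v')⁻¹ :=
      funext fun v' ↦ (hasDerivAt_eval_invRadius_vDerivPoly hr hM P u v').deriv
    rw [hd, ih]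

/-- The cofactor recursion: `δ^m (X^j S) = X^{j+m} S_m` with `S_0 = S`,
`S_{m+1} = −((j+m) S_m + X S_m') (1 − 2M X)`. [folklore] -/
def vDerivCofactor (M : ℝ) (j : ℕ) (S : ℝ[X]) : ℕ → ℝ[X]
  | 0 => S
  | m + 1 => -((C ((j : ℝ) + m) * vDerivCofactor M j S m + X * derivative (vDerivCofactor M j S m)) *
      (1 - C (2 * M) * X))

/-- `δ (X^n S) = X^{n+1} · (−(n S + X S')(1 − 2M X))` for `n ≥ 1`. [folklore] -/
lemma vDerivPoly_X_pow_mul {n : ℕ} (hn : 1 ≤ n) (S : ℝ[X]) :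
    vDerivPoly M (X ^ n * S) =
      X ^ (n + 1) * -((C (n : ℝ) * S + X * derivative S) * (1 - C (2 * M) * X)) := by
  obtain ⟨k, rfl⟩ : ∃ k, n = k + 1 := ⟨n - 1, by omega⟩
  simp only [vDerivPoly, invRadiusDerivPoly, derivative_mul, derivative_X_pow, Nat.add_sub_cancel]
  push_cast
  ring

/-- **`δ^m (X^j S) = X^{j+m} S_m`** (`j ≥ 1`). [folklore] -/
theorem iterate_vDerivPoly_X_pow_mul {j : ℕ} (hj : 1 ≤ j) (S : ℝ[X]) (m : ℕ) :
    (vDerivPoly M)^[m] (X ^ j * S) = X ^ (j + m) * vDerivCofactor M j S m := by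
  induction m with
  | zero => simp [vDerivCofactor]
  | succ m ih =>
    rw [Function.iterate_succ_apply', ih, vDerivPoly_X_pow_mul (by omega)]
    simp only [vDerivCofactor]
    push_cast
    ring

/-- `V = X³ · (2M − 4M² X)` at `X = 1/r`. [folklore] -/
lemma potentialPoly_eq_X_pow_mul (M : ℝ) : potentialPoly M = X ^ 3 * (C (2 * M) - C (4 * M ^ 2) * X) := by
  simp only [potentialPoly]; ring

include hr hM in
/-- **`∂ᵥ^m V(r(u, ·)) = ρ^{3+m} S_m(ρ)`**, `ρ = 1/r(u,v)`, with the cofactors of `potentialPoly`.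
[folklore] -/
theorem iteratedDeriv_potential_eq (m : ℕ) (u v : ℝ) :
    iteratedDeriv m (fun v' ↦ radialPotential M (r u v')) v =
      ((r u v)⁻¹) ^ (3 + m) * (vDerivCofactor M 3 (C (2 * M) - C (4 * M ^ 2) * X) m).eval (r u v)⁻¹ := by
  have heq : (fun v' ↦ radialPotential M (r u v')) = fun v' ↦ (potentialPoly M).eval (r u v')⁻¹ :=
    funext fun v' ↦ radialPotential_eq_eval hr hM u v'
  rw [heq, iteratedDeriv_eval_invRadius hr hM, potentialPoly_eq_X_pow_mul,
    iterate_vDerivPoly_X_pow_mul (by norm_num)]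
  simp [eval_mul, eval_pow]

include hr hM in
/-- **`|∂ᵥ^m V(r(u, ·))| ≤ K_m / r^{3+m}`.** [folklore] -/
theorem abs_iteratedDeriv_potential_le (m : ℕ) :
    ∃ K : ℝ, 0 ≤ K ∧ ∀ u v, |iteratedDeriv m (fun v' ↦ radialPotential M (r u v')) v| ≤ K * (r u v ^ (3 + m))⁻¹ := by
  obtain ⟨K, hK⟩ := exists_bound_eval_invRadius hr hM (vDerivCofactor M 3 (C (2 * M) - C (4 * M ^ 2) * X) m)
  refine ⟨K, (abs_nonneg _).trans (hK 0 0), fun u v ↦ ?_⟩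
  rw [iteratedDeriv_potential_eq hr hM, abs_mul, ← inv_pow, abs_of_nonneg
    (by have := hr.pos hM.le u v; positivity), mul_comm]
  exact mul_le_mul_of_nonneg_right (hK u v) (by have := hr.pos hM.le u v; positivity)

include hr hM in
/-- `v ↦ P(1/r(u, v))` is smooth. [folklore] -/
theorem contDiff_eval_invRadius_right (P : ℝ[X]) (u : ℝ) :
    ContDiff ℝ ((⊤ : ℕ∞) : WithTop ℕ∞) (fun v ↦ P.eval (r u v)⁻¹) := by
  have hρ : ContDiff ℝ ((⊤ : ℕ∞) : WithTop ℕ∞) (fun v ↦ (r u v)⁻¹) :=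
    ((hr.contDiff_uncurry hM).comp (contDiff_prodMk_right u)).inv fun v ↦ (hr.pos hM.le u v).ne'
  have h := (Polynomial.contDiff_aeval (𝕜 := ℝ) P ((⊤ : ℕ∞) : WithTop ℕ∞)).comp hρ
  simpa [Function.comp_def] using h

include hr hM in
/-- `v ↦ V(r(u, v))` is smooth. [folklore] -/
theorem contDiff_potential_right (u : ℝ) :
    ContDiff ℝ ((⊤ : ℕ∞) : WithTop ℕ∞) (fun v ↦ radialPotential M (r u v)) := by
  have heq : (fun v' ↦ radialPotential M (r u v')) = fun v' ↦ (potentialPoly M).eval (r u v')⁻¹ :=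
    funext fun v' ↦ radialPotential_eq_eval hr hM u v'
  rw [heq]; exact contDiff_eval_invRadius_right hr hM _ u

end VDerivPoly

/-! ### `v`-derivatives of the bootstrap family and of `Ξ` -/

section VFamily

variable {M : ℝ} {r : ℝ → ℝ → ℝ} {v₁ : ℝ} {H : ℝ → ℝ} {ψ f : ℝ → ℝ → ℝ}
variable (hr : IsEFAreaRadius M r) (hM : 0 < M) (hb : ScatBootstrap M r v₁ H ψ)
include hr hM hb

/-- Slices `v ↦ f(u, v)` of members are smooth. [folklore] -/
theorem contDiff_right (hf : ScatFam M r v₁ H ψ f) (u : ℝ) :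
    ContDiff ℝ ((⊤ : ℕ∞) : WithTop ℕ∞) (fun v ↦ f u v) :=
  (ScatFam.contDiff hr hM hb hf).comp (contDiff_prodMk_right u)

/-- Slices `v ↦ V(u,v) f(u, v)` are smooth. [folklore] -/
theorem contDiff_potential_mul_right (hf : ScatFam M r v₁ H ψ f) (u : ℝ) :
    ContDiff ℝ ((⊤ : ℕ∞) : WithTop ℕ∞) (fun v ↦ radialPotential M (r u v) * f u v) :=
  (contDiff_potential_right hr hM u).mul (contDiff_right hr hM hb hf u)

/-- **`∂ᵥ^m (V f) = V · f_m` with `f_m` in the bootstrap family** (`f_{m+1} = εᵥ(1)(ρ) f_m + ∂ᵥ f_m`).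
[folklore] -/
theorem exists_iteratedDeriv_potential_mul (hf : ScatFam M r v₁ H ψ f) (m : ℕ) :
    ∃ fm : ℝ → ℝ → ℝ, ScatFam M r v₁ H ψ fm ∧ ∀ u v,
      iteratedDeriv m (fun v' ↦ radialPotential M (r u v') * f u v') v = radialPotential M (r u v) * fm u v := by
  induction m with
  | zero => exact ⟨f, hf, fun u v ↦ by simp⟩
  | succ m ih =>
    obtain ⟨fm, hfm, heq⟩ := ih
    obtain ⟨_, f₂, -, hf₂, -, hd₂⟩ := ScatFam.exists_hasDerivAt hr hM hb hfm
    refine ⟨fun u v ↦ (potentialDerivPoly M 1).eval (r u v)⁻¹ * fm u v + f₂ u v,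
      ScatFam.add (ScatFam.smul _ hfm) hf₂, fun u v ↦ ?_⟩
    have hfun : iteratedDeriv m (fun v' ↦ radialPotential M (r u v') * f u v') =
        fun v' ↦ radialPotential M (r u v') * fm u v' := funext fun v' ↦ heq u v'
    rw [iteratedDeriv_succ, hfun]
    -- `∂ᵥ (V fm) = V (εᵥ(1)(ρ) fm + fm₂)`
    have h1 : HasDerivAt (fun v' ↦ (potentialPoly M).eval (r u v')⁻¹ * fm u v')
        (-(derivative (potentialPoly M) * invRadiusDerivPoly M).eval (r u v)⁻¹ * fm u v +
          (potentialPoly M).eval (r u v)⁻¹ * f₂ u v) v :=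
      (hasDerivAt_eval_invRadius_right hr hM _ u v).mul (hd₂ u v)
    have heq' : (fun v' ↦ radialPotential M (r u v') * fm u v') =
        fun v' ↦ (potentialPoly M).eval (r u v')⁻¹ * fm u v' :=
      funext fun v' ↦ by rw [radialPotential_eq_eval hr hM]
    rw [heq']
    refine (h1.congr_deriv ?_).deriv
    have hid := congrArg (fun Q : ℝ[X] ↦ Q.eval (r u v)⁻¹) (potentialPoly_identity M 1)
    simp only [mul_one, eval_mul, eval_neg] at hid
    rw [radialPotential_eq_eval hr hM]
    simp only [eval_mul, neg_mul] at hid ⊢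
    linear_combination (fm u v) * hid

/-- Continuity and potential domination of `∂ᵥ^m (V f)`, from the representation `V · f_m`.
[folklore] -/
theorem continuous_iteratedDeriv_potential_mul (hf : ScatFam M r v₁ H ψ f) (m : ℕ) :
    Continuous (uncurry fun u v ↦ iteratedDeriv m (fun v' ↦ radialPotential M (r u v') * f u v') v) ∧
      IsPotentialDominated M r (fun u v ↦ iteratedDeriv m (fun v' ↦ radialPotential M (r u v') * f u v') v) := by
  obtain ⟨fm, hfm, heq⟩ := exists_iteratedDeriv_potential_mul hr hM hb hf m
  have hfun : (fun u v ↦ iteratedDeriv m (fun v' ↦ radialPotential M (r u v') * f u v') v) =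
      fun u v ↦ radialPotential M (r u v) * ((C (1 : ℝ)).eval (r u v)⁻¹ * fm u v) := by
    funext u v; rw [heq u v, eval_C, one_mul]
  refine ⟨?_, ?_⟩
  · rw [show (uncurry fun u v ↦ iteratedDeriv m (fun v' ↦ radialPotential M (r u v') * f u v') v) =
        uncurry fun u v ↦ radialPotential M (r u v) * ((C (1 : ℝ)).eval (r u v)⁻¹ * fm u v) by rw [hfun]]
    exact ScatFam.continuous_uprimIntegrand hr hM hb (C 1) hfm
  · rw [hfun]
    exact ScatFam.isPotentialDominated_uprimIntegrand hr hM hb (C 1) hfm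

/-- **`∂ᵥ^m ∫_{−∞}^{u} V f = ∫_{−∞}^{u} ∂ᵥ^m (V f)`** for members `f` of the bootstrap family
(differentiation under the integral sign, `hasDerivAt_uPrimitive_right`, iterated). [folklore] -/
theorem iteratedDeriv_uPrimitive (hf : ScatFam M r v₁ H ψ f) (m : ℕ) (u v : ℝ) :
    iteratedDeriv m (fun v' ↦ uPrimitive (fun u v ↦ radialPotential M (r u v) * f u v) u v') v =
      uPrimitive (fun u v ↦ iteratedDeriv m (fun v' ↦ radialPotential M (r u v') * f u v') v) u v := by
  induction m generalizing v with
  | zero => simp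
  | succ m ih =>
    set F : ℕ → ℝ → ℝ → ℝ := fun m u v ↦ iteratedDeriv m (fun v' ↦ radialPotential M (r u v') * f u v') v
      with hF
    have hcm := continuous_iteratedDeriv_potential_mul hr hM hb hf m
    have hcm1 := continuous_iteratedDeriv_potential_mul hr hM hb hf (m + 1)
    have hd : ∀ u v, HasDerivAt (fun v' ↦ F m u v') (F (m + 1) u v) v := by
      intro u v
      have hdiff := (contDiff_potential_mul_right hr hM hb hf u).differentiable_iteratedDeriv m
        (by exact_mod_cast ENat.coe_lt_top m)
      simp only [hF, iteratedDeriv_succ]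
      exact hdiff.differentiableAt.hasDerivAt
    have key := hasDerivAt_uPrimitive_right hr hM hcm.2 hcm.1 hcm1.2 hcm1.1 hd u v
    have hfun : iteratedDeriv m (fun v' ↦ uPrimitive (fun u v ↦ radialPotential M (r u v) * f u v) u v') =
        fun v' ↦ uPrimitive (F m) u v' := funext fun v' ↦ ih v'
    rw [iteratedDeriv_succ, hfun]
    exact key.deriv

end VFamily

/-! ### `v`-derivatives of the scattering field -/

section FieldDeriv

variable {M : ℝ} {r : ℝ → ℝ → ℝ} {v₁ v₂ U₀ A : ℝ} {H : ℝ → ℝ} {CH : ℝ}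
variable (hr : IsEFAreaRadius M r) (hM : 0 < M)
  (hHd : ContDiff ℝ ((⊤ : ℕ∞) : WithTop ℕ∞) H) (hsupp : tsupport H ⊆ Ioo v₁ v₂)
  (hHb : ∀ v, |H v| ≤ CH)
include hr hM

omit hr hM in
/-- All derivatives of the data vanish on `[v₂, ∞)`. [folklore] -/
lemma iteratedDeriv_data_eq_zero_of_ge (hsupp : tsupport H ⊆ Ioo v₁ v₂) (j : ℕ) {v : ℝ} (hv : v₂ ≤ v) :
    iteratedDeriv j H v = 0 := by
  refine image_eq_zero_of_notMem_tsupport fun h ↦ ?_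
  have := hsupp (tsupport_iteratedDeriv_subset H j h)
  exact absurd this.2 (not_lt.2 hv)

/-- `Ξ = ∫_{−∞}^{u} Vχ` is a member of the bootstrap family of `χ`. [folklore] -/
lemma uPrimitive_mem :
    ScatFam M r v₁ H (scatteringField hr hM hHd.continuous hHb (data_eq_zero hsupp))
      (uPrimitive fun u v ↦ radialPotential M (r u v) *
        scatteringField hr hM hHd.continuous hHb (data_eq_zero hsupp) u v) := by
  have h := ScatFam.uprim (M := M) (r := r) (v₁ := v₁) (H := H)
    (ψ := scatteringField hr hM hHd.continuous hHb (data_eq_zero hsupp)) (C 1) ScatFam.sol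
  simpa using h

/-- **`∂ᵥ^{m+1} χ = H^{(m+1)} − ∫_{−∞}^{u} ∂ᵥ^m (Vχ)`.** [folklore] -/
theorem iteratedDeriv_succ_field (m : ℕ) (u v : ℝ) :
    iteratedDeriv (m + 1) (fun v' ↦ scatteringField hr hM hHd.continuous hHb (data_eq_zero hsupp) u v') v =
      iteratedDeriv (m + 1) H v - uPrimitive (fun u v ↦ iteratedDeriv m (fun v' ↦ radialPotential M (r u v') *
        scatteringField hr hM hHd.continuous hHb (data_eq_zero hsupp) u v') v) u v := by
  set χ := scatteringField hr hM hHd.continuous hHb (data_eq_zero hsupp) with hχ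
  have hb : ScatBootstrap M r v₁ H χ := scatBootstrap_scatteringField hr hM hHd hsupp hHb
  have hderiv : deriv (fun v' ↦ χ u v') =
      fun v' ↦ deriv H v' - uPrimitive (fun u v ↦ radialPotential M (r u v) * χ u v) u v' :=
    funext fun v' ↦ (hb.deriv_right u v').deriv
  rw [iteratedDeriv_succ', hderiv]
  have hH1 : ContDiff ℝ ((⊤ : ℕ∞) : WithTop ℕ∞) (deriv H) := (contDiff_infty_iff_deriv.1 hHd).2
  have hΞ : ContDiff ℝ ((⊤ : ℕ∞) : WithTop ℕ∞)
      (fun v' ↦ uPrimitive (fun u v ↦ radialPotential M (r u v) * χ u v) u v') :=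
    contDiff_right hr hM hb (uPrimitive_mem hr hM hHd hsupp hHb) u
  have hle : ((m : ℕ) : WithTop ℕ∞) ≤ ((⊤ : ℕ∞) : WithTop ℕ∞) := by exact_mod_cast le_top
  rw [iteratedDeriv_fun_sub (hH1.of_le hle).contDiffAt (hΞ.of_le hle).contDiffAt,
    ← iteratedDeriv_succ', iteratedDeriv_uPrimitive hr hM hb ScatFam.sol m u v]

/-- **`∂ᵥ^{m+1} χ(u, v) = −∫_{−∞}^{u} ∂ᵥ^m (Vχ)` for `v ≥ v₂`.** [folklore] -/
theorem iteratedDeriv_succ_field_of_ge (m : ℕ) (u : ℝ) {v : ℝ} (hv : v₂ ≤ v) :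
    iteratedDeriv (m + 1) (fun v' ↦ scatteringField hr hM hHd.continuous hHb (data_eq_zero hsupp) u v') v =
      -uPrimitive (fun u v ↦ iteratedDeriv m (fun v' ↦ radialPotential M (r u v') *
        scatteringField hr hM hHd.continuous hHb (data_eq_zero hsupp) u v') v) u v := by
  rw [iteratedDeriv_succ_field hr hM hHd hsupp hHb, iteratedDeriv_data_eq_zero_of_ge hsupp _ hv, zero_sub]

end FieldDeriv

/-! ### Decay of the `v`-derivatives of the scattering field -/

section VDecay

variable {M : ℝ} {r : ℝ → ℝ → ℝ} {v₁ v₂ U₀ A : ℝ} {H : ℝ → ℝ} {CH : ℝ}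
variable (hr : IsEFAreaRadius M r) (hM : 0 < M)
  (hHd : ContDiff ℝ ((⊤ : ℕ∞) : WithTop ℕ∞) H) (hsupp : tsupport H ⊆ Ioo v₁ v₂)
  (hHb : ∀ v, |H v| ≤ CH) (hR : GoodRegion M r v₁ v₂ U₀ A)
include hr hM hR

/-- **The induction step of the `v`-derivative bounds.** If `|∂ᵥ^j χ| ≤ C_p/(|u| r^{j+2})` on
`{u ≤ U₀, v ≥ v₂}` for `1 ≤ j ≤ b`, then `|∂ᵥ^{b+1} χ| ≤ C/(|u| r^{b+3})` there: by
`∂ᵥ^{b+1}χ = −∫_{−∞}^{u} ∂ᵥ^b(Vχ)`, the Leibniz rule, `|∂ᵥ^i V| ≤ K_i/r^{3+i}`, `|χ| ≤ B₂/u'²` and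
the `U`-rule (the terms with `j ≥ 1` are even smaller by `1/r² ≤ 4/u'²`). [folklore] -/
theorem abs_iteratedDeriv_succ_le_of_lower (h12 : v₁ ≤ v₂) (b : ℕ) {Cp : ℝ} (hCp : 0 ≤ Cp)
    (hprev : ∀ j, 1 ≤ j → j ≤ b → ∀ u, u ≤ U₀ → ∀ v, v₂ ≤ v →
      |iteratedDeriv j (fun v' ↦ scatteringField hr hM hHd.continuous hHb (data_eq_zero hsupp) u v') v| ≤
        Cp * ((-u)⁻¹ * (r u v ^ (j + 2))⁻¹)) :
    ∃ C : ℝ, 0 ≤ C ∧ ∀ u, u ≤ U₀ → ∀ v, v₂ ≤ v →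
      |iteratedDeriv (b + 1) (fun v' ↦ scatteringField hr hM hHd.continuous hHb (data_eq_zero hsupp) u v') v| ≤
        C * ((-u)⁻¹ * (r u v ^ (b + 3))⁻¹) := by
  set χ := scatteringField hr hM hHd.continuous hHb (data_eq_zero hsupp) with hχ
  have hb : ScatBootstrap M r v₁ H χ := scatBootstrap_scatteringField hr hM hHd hsupp hHb
  choose K hK0 hK using fun i ↦ abs_iteratedDeriv_potential_le hr hM i
  have hB2 : 0 ≤ sqConst M CH v₁ v₂ := sqConst_nonneg (v₁ := v₁) (v₂ := v₂) hM hHb h12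
  set w : ℕ → ℝ := fun i ↦ if i = b then (b.choose i : ℝ) * K i * sqConst M CH v₁ v₂
    else 4 * (b.choose i : ℝ) * K i * Cp with hw
  have hw0 : ∀ i, 0 ≤ w i := by
    intro i
    by_cases hi : i = b
    · simp only [hw, hi, if_true]; exact mul_nonneg (mul_nonneg (Nat.cast_nonneg _) (hK0 _)) hB2
    · simp only [hw, hi, if_false]
      exact mul_nonneg (mul_nonneg (mul_nonneg (by norm_num) (Nat.cast_nonneg _)) (hK0 _)) hCp
  set T : ℝ := ∑ i ∈ Finset.range (b + 1), w i with hT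
  have hT0 : 0 ≤ T := Finset.sum_nonneg fun i _ ↦ hw0 i
  refine ⟨T, hT0, fun u hu v hv ↦ ?_⟩
  have hle : ((b : ℕ) : WithTop ℕ∞) ≤ ((⊤ : ℕ∞) : WithTop ℕ∞) := by exact_mod_cast le_top
  -- the bound on the integrand `∂ᵥ^b (Vχ)(u', v)` along the ray `u' ≤ u`
  have hint : ∀ u', u' ≤ u → |iteratedDeriv b (fun v' ↦ radialPotential M (r u' v') * χ u' v') v| ≤
      T * (((-u') ^ (0 + 2))⁻¹ * (r u' v ^ (b + 3))⁻¹) := by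
    intro u' hu'
    have hu'U : u' ≤ U₀ := hu'.trans hu
    have hu'0 : 0 < -u' := hR.neg_pos hu'U
    have hu'3 : 3 ≤ -u' := hR.three_le hu'U
    have hr0 : 0 < r u' v := hr.pos hM.le u' v
    have hρ : (r u' v)⁻¹ ≤ 2 / -u' := hR.inv_radius_le hr hM hu'U (h12.trans hv)
    have hVc : ContDiffAt ℝ b (fun v' ↦ radialPotential M (r u' v')) v :=
      ((contDiff_potential_right hr hM u').of_le hle).contDiffAt
    have hχc : ContDiffAt ℝ b (fun v' ↦ χ u' v') v :=
      ((contDiff_right hr hM hb ScatFam.sol u').of_le hle).contDiffAt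
    rw [iteratedDeriv_fun_mul hVc hχc]
    -- termwise bound
    have hterm : ∀ i ∈ Finset.range (b + 1),
        |(b.choose i : ℝ) * iteratedDeriv i (fun v' ↦ radialPotential M (r u' v')) v *
          iteratedDeriv (b - i) (fun v' ↦ χ u' v') v| ≤ w i * ((u' ^ 2)⁻¹ * (r u' v ^ (b + 3))⁻¹) := by
      intro i hi
      have hib : i ≤ b := Nat.lt_succ_iff.mp (Finset.mem_range.mp hi)
      rw [abs_mul, abs_mul, Nat.abs_cast]
      have h1 := hK i u' v
      rcases eq_or_lt_of_le hib with rfl | hlt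
      · -- the term with `χ` itself: `|χ| ≤ B₂/u'²`
        have h2 : |χ u' v| ≤ sqConst M CH v₁ v₂ * (u' ^ 2)⁻¹ := by
          have h := abs_sub_data_le_sqConst hr hM hHd hsupp hHb hR h12 hu'U v
          rwa [data_eq_zero_of_ge hsupp hv, sub_zero] at h
        simp only [hw, if_true, Nat.sub_self, iteratedDeriv_zero]
        calc (i.choose i : ℝ) * |iteratedDeriv i (fun v' ↦ radialPotential M (r u' v')) v| * |χ u' v|
            ≤ (i.choose i : ℝ) * (K i * (r u' v ^ (3 + i))⁻¹) * (sqConst M CH v₁ v₂ * (u' ^ 2)⁻¹) :=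
              mul_le_mul (mul_le_mul_of_nonneg_left h1 (Nat.cast_nonneg _)) h2 (abs_nonneg _)
                (mul_nonneg (Nat.cast_nonneg _) (mul_nonneg (hK0 _) (by positivity)))
          _ = (i.choose i : ℝ) * K i * sqConst M CH v₁ v₂ * ((u' ^ 2)⁻¹ * (r u' v ^ (i + 3))⁻¹) := by
              rw [add_comm 3 i]; ring
      · -- the terms with `∂ᵥ^j χ`, `j = b - i ≥ 1`
        have hj1 : 1 ≤ b - i := by omega
        have h2 := hprev (b - i) hj1 (Nat.sub_le _ _) u' hu'U v hv
        simp only [hw, if_neg (ne_of_lt hlt)]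
        have hexp : (r u' v ^ (3 + i))⁻¹ * (r u' v ^ (b - i + 2))⁻¹ = (r u' v ^ 2)⁻¹ * (r u' v ^ (b + 3))⁻¹ := by
          rw [← mul_inv, ← pow_add, ← mul_inv, ← pow_add]
          congr 2
          omega
        have hsmall : (-u')⁻¹ * (r u' v ^ 2)⁻¹ ≤ 4 * (u' ^ 2)⁻¹ := by
          have h3 : (-u')⁻¹ ≤ 1 := by
            rw [inv_le_comm₀ hu'0 one_pos, inv_one]; linarith
          have h4 : (r u' v ^ 2)⁻¹ ≤ (2 / -u') ^ 2 := by
            rw [← inv_pow]; exact pow_le_pow_left₀ (by positivity) hρ 2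
          calc (-u')⁻¹ * (r u' v ^ 2)⁻¹ ≤ 1 * (2 / -u') ^ 2 :=
                mul_le_mul h3 h4 (by positivity) zero_le_one
            _ = 4 * (u' ^ 2)⁻¹ := by field_simp; ring
        calc (b.choose i : ℝ) * |iteratedDeriv i (fun v' ↦ radialPotential M (r u' v')) v| *
              |iteratedDeriv (b - i) (fun v' ↦ χ u' v') v|
            ≤ (b.choose i : ℝ) * (K i * (r u' v ^ (3 + i))⁻¹) * (Cp * ((-u')⁻¹ * (r u' v ^ (b - i + 2))⁻¹)) :=
              mul_le_mul (mul_le_mul_of_nonneg_left h1 (Nat.cast_nonneg _)) h2 (abs_nonneg _)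
                (mul_nonneg (Nat.cast_nonneg _) (mul_nonneg (hK0 _) (by positivity)))
          _ = (b.choose i : ℝ) * K i * Cp * (((-u')⁻¹ * (r u' v ^ 2)⁻¹) * (r u' v ^ (b + 3))⁻¹) := by
              rw [show (b.choose i : ℝ) * (K i * (r u' v ^ (3 + i))⁻¹) * (Cp * ((-u')⁻¹ * (r u' v ^ (b - i + 2))⁻¹))
                = (b.choose i : ℝ) * K i * Cp * (-u')⁻¹ * ((r u' v ^ (3 + i))⁻¹ * (r u' v ^ (b - i + 2))⁻¹) by ring,
                hexp]
              ring
          _ ≤ (b.choose i : ℝ) * K i * Cp * ((4 * (u' ^ 2)⁻¹) * (r u' v ^ (b + 3))⁻¹) :=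
              mul_le_mul_of_nonneg_left (mul_le_mul_of_nonneg_right hsmall (by positivity))
                (mul_nonneg (mul_nonneg (Nat.cast_nonneg _) (hK0 _)) hCp)
          _ = 4 * (b.choose i : ℝ) * K i * Cp * ((u' ^ 2)⁻¹ * (r u' v ^ (b + 3))⁻¹) := by ring
    refine (Finset.abs_sum_le_sum_abs _ _).trans ?_
    refine (Finset.sum_le_sum hterm).trans (le_of_eq ?_)
    rw [← Finset.sum_mul]
    congr 1
    ring
  -- the `U`-rule
  have hU := abs_uPrimitive_le_U hr hM hR (C := T) (a := 0) (b := b + 3) hu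
    (h := fun u v ↦ iteratedDeriv b (fun v' ↦ radialPotential M (r u v') * χ u v') v) (v := v) hint
  rw [iteratedDeriv_succ_field_of_ge hr hM hHd hsupp hHb b u hv, abs_neg]
  refine hU.trans (le_of_eq ?_)
  norm_num

/-- **Decay of all `v`-derivatives of the scattering field towards `𝓘⁺` and `𝓘⁻`**:
`|∂ᵥ^j χ(u, v)| ≤ C_b/(|u| r(u,v)^{j+2})` on `{u ≤ U₀, v ≥ v₂}` for `1 ≤ j ≤ b + 1` (Kehrberger:
"`∂ᵥ(rφ) ∼ |u|⁻¹ r⁻³`" towards `𝓘⁺`, proof of Thm. 4.3, here with all `v`-derivatives).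
[cite: Kehrberger2022AHP, proof of Thm. 4.3] -/
theorem abs_iteratedDeriv_le (h12 : v₁ ≤ v₂) (b : ℕ) :
    ∃ C : ℝ, 0 ≤ C ∧ ∀ j, 1 ≤ j → j ≤ b + 1 → ∀ u, u ≤ U₀ → ∀ v, v₂ ≤ v →
      |iteratedDeriv j (fun v' ↦ scatteringField hr hM hHd.continuous hHb (data_eq_zero hsupp) u v') v| ≤
        C * ((-u)⁻¹ * (r u v ^ (j + 2))⁻¹) := by
  induction b with
  | zero =>
    obtain ⟨C, hC0, hC⟩ := abs_iteratedDeriv_succ_le_of_lower hr hM hHd hsupp hHb hR h12 0 le_rfl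
      (fun j hj hj' ↦ absurd (hj.trans hj') (by norm_num))
    refine ⟨C, hC0, fun j hj hj' u hu v hv ↦ ?_⟩
    obtain rfl : j = 1 := le_antisymm hj' hj
    exact hC u hu v hv
  | succ b ih =>
    obtain ⟨C, hC0, hC⟩ := ih
    obtain ⟨C', hC'0, hC'⟩ := abs_iteratedDeriv_succ_le_of_lower hr hM hHd hsupp hHb hR h12 (b + 1) hC0 hC
    refine ⟨max C C', le_max_of_le_left hC0, fun j hj hj' u hu v hv ↦ ?_⟩
    have hpos : 0 ≤ (-u)⁻¹ * (r u v ^ (j + 2))⁻¹ := by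
      have := hR.neg_pos hu; have := hr.pos hM.le u v; positivity
    rcases Nat.lt_or_ge j (b + 2) with hlt | hge
    · exact (hC j hj (by omega) u hu v hv).trans (mul_le_mul_of_nonneg_right (le_max_left _ _) hpos)
    · obtain rfl : j = b + 2 := le_antisymm hj' hge
      exact (hC' u hu v hv).trans (mul_le_mul_of_nonneg_right (le_max_right _ _) hpos)

end VDecay

end ScatDecay

end Literature.Barriers.FinalStateConjecture

end
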